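import Literature.RingTheory.LocalCohomology.CechVanishing
import HarnessLib

/-!
# Dropping a generator that acts nilpotently: `H_{(z, y)}(M) = H_{(y)}(M)` for `z`-power-torsion `M`

Topic `Literature/RingTheory/LocalCohomology`, sequel of `CechVanishing.lean`. If every element of
the `R`-module `M` is killed by a power of `z ∈ R` (e.g. `zM = 0`), then the Čech complexes of `M`
with respect to `z, y_1, …, y_s` and with respect to `y_1, …, y_s` are isomorphic: the localisation
`M_{y_t}` attached to a tuple `t` through the longer family vanishes as soon as `t` meets the index
of `z`, and the remaining tuples are exactly the tuples of the shorter family. Consequently the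
vanishing of local cohomology below any degree is the same for the two families
(`cechVanishBelow_cons_iff_of_torsion`) — the Čech shadow of `H^i_{(z,y)} = H^i_{(y)}` on
`z^∞`-torsion modules (The Stacks Project, Tag 0A6R / the "complex interpretation" used in
Česnavičius 2021, proof of Thm. 3.13, (punch-2) and (bam-3)).

Contents: the canonical identifications `M_{y_t} ≅ M_{(z,y)_{succ ∘ t}}` (`consIso`), the
restriction chain map `dropZero` from cochains for `(z, y)` to cochains for `y`, its compatibility
with the differentials and the augmentation, its bijectivity for `z`-power-torsion `M`, and a
general transfer lemma for the three vanishing clauses along a bijective chain map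
(`cechVanishBelow_iff_of_bijective`). Everything is proved; no named facts.

## References

* [StacksProject] The Stacks Project, Tag 0A6R (local cohomology and the extended Čech complex).
* [Cesnavicius2021] K. Česnavičius, *Macaulayfication of Noetherian schemes*, Duke Math. J. 170
  (2021), proof of Thm. 3.13.
* [Grothendieck1968SGA2] A. Grothendieck, SGA 2, Exp. II.
-/

noncomputable section

universe u

namespace Literature.RingTheory.LocalCohomology

open Pointwise

variable {R : Type u} [CommRing R] {s : ℕ} (z : R) (y : Fin s → R) (M : Type u) [AddCommGroup M]
  [Module R M]

/-! ## Transfer of the clauses along a bijective chain map -/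

section Transfer

variable {z y M} {s' : ℕ} {y' : Fin s' → R}

/-- **A bijective chain map between extended Čech complexes identifies the vanishing clauses**:
if `ρ_n : Čⁿ(y'; M) → Čⁿ(y; M)` are bijective linear maps commuting with the differentials and
the augmentations, then `Hⁱ_{(y')}(M) = 0` below `n` iff `Hⁱ_{(y)}(M) = 0` below `n`. [folklore] -/
theorem cechVanishBelow_iff_of_bijective (ρ : ∀ n, CechObj y' M n →ₗ[R] CechObj y M n)
    (hbij : ∀ n, Function.Bijective (ρ n))
    (hd : ∀ (n : ℕ) (c : CechObj y' M n), dC n (ρ n c) = ρ (n + 1) (dC n c))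
    (haug : ∀ m : M, ρ 0 (cechAug y' M m) = cechAug y M m) {n : ℕ} :
    CechVanishBelow y' M n ↔ CechVanishBelow y M n := by
  set e : ∀ n, CechObj y' M n ≃ₗ[R] CechObj y M n := fun n => LinearEquiv.ofBijective (ρ n) (hbij n)
    with he
  have he' : ∀ n c, e n c = ρ n c := fun n c => rfl
  have haug' : ∀ m : M, cechAug y M m = e 0 (cechAug y' M m) := fun m => (haug m).symm
  have hd' : ∀ (q : ℕ) (c : CechObj y' M q), dC q (e q c) = e (q + 1) (dC q c) :=
    fun q c => hd q c
  constructor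
  · rintro ⟨h0, h1, h2⟩
    refine ⟨fun hn m hm => h0 hn m ?_, fun hn c hc => ?_, fun q hq c hc => ?_⟩
    · apply (e 0).injective
      rw [← haug', hm, map_zero]
    · obtain ⟨m, hm⟩ := h1 hn ((e 0).symm c) (by
        apply (e 1).injective
        rw [← hd', LinearEquiv.apply_symm_apply, hc, map_zero])
      exact ⟨m, by rw [haug', hm, LinearEquiv.apply_symm_apply]⟩
    · obtain ⟨b, hb⟩ := h2 q hq ((e (q + 1)).symm c) (by
        apply (e (q + 2)).injective
        rw [← hd', LinearEquiv.apply_symm_apply, hc, map_zero])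
      exact ⟨e q b, by rw [hd', hb, LinearEquiv.apply_symm_apply]⟩
  · rintro ⟨h0, h1, h2⟩
    refine ⟨fun hn m hm => h0 hn m (by rw [haug', hm, map_zero]), fun hn c hc => ?_,
      fun q hq c hc => ?_⟩
    · obtain ⟨m, hm⟩ := h1 hn (e 0 c) (by rw [hd', hc, map_zero])
      exact ⟨m, (e 0).injective (by rw [← haug', hm])⟩
    · obtain ⟨b, hb⟩ := h2 q hq (e (q + 1) c) (by rw [hd', hc, map_zero])
      refine ⟨(e q).symm b, (e (q + 1)).injective ?_⟩
      rw [← hd', LinearEquiv.apply_symm_apply, hb]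

end Transfer

/-! ## Tuples through `(z, y)` versus tuples through `y` -/

/-- The product over a tuple avoiding the index of `z` is the product over the corresponding
`y`-tuple. [folklore] -/
theorem tupleProd_cons_succ {n : ℕ} (t : Fin n → Fin s) :
    tupleProd (Fin.cons z y : Fin (s + 1) → R) (Fin.succ ∘ t) = tupleProd y t := by
  simp only [tupleProd, Function.comp_apply, Fin.cons_succ]

/-- A tuple meeting the index of `z` has a product divisible by `z`. [folklore] -/
theorem dvd_tupleProd_cons_of_eq_zero {n : ℕ} (t : Fin n → Fin (s + 1)) {k : Fin n}
    (hk : t k = 0) : z ∣ tupleProd (Fin.cons z y : Fin (s + 1) → R) t := by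
  have : (Fin.cons z y : Fin (s + 1) → R) (t k) ∣ tupleProd (Fin.cons z y : Fin (s + 1) → R) t :=
    Finset.dvd_prod_of_mem _ (Finset.mem_univ k)
  rwa [hk, Fin.cons_zero] at this

variable {z y M} in
/-- If `M` is `z`-power torsion and `z ∣ a`, the localisation `M[a⁻¹]` vanishes. [folklore] -/
theorem localizedModule_eq_zero_of_dvd (hM : ∀ m : M, ∃ N : ℕ, z ^ N • m = 0) {a : R}
    (ha : z ∣ a) (x : LocalizedModule (Submonoid.powers a) M) : x = 0 := by
  induction x using LocalizedModule.induction_on with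
  | h m k =>
    obtain ⟨N, hN⟩ := hM m
    obtain ⟨c, rfl⟩ := ha
    rw [← LocalizedModule.zero_mk k, LocalizedModule.mk_eq]
    refine ⟨⟨(z * c) ^ N, N, rfl⟩, ?_⟩
    simp only [smul_zero]
    show (z * c) ^ N • ((k : R) • m) = 0
    rw [smul_comm, mul_pow, mul_comm (z ^ N) (c ^ N), mul_smul, hN, smul_zero, smul_zero]

variable {z y M} in
/-- If `M` is `z`-power torsion, the localisation of `M` at a tuple meeting the index of `z`
vanishes. [cite: StacksProject, Tag 0A6R] -/
theorem cechLoc_cons_eq_zero (hM : ∀ m : M, ∃ N : ℕ, z ^ N • m = 0) {n : ℕ}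
    (t : Fin n → Fin (s + 1)) {k : Fin n} (hk : t k = 0)
    (x : CechLoc (Fin.cons z y : Fin (s + 1) → R) M t) : x = 0 :=
  localizedModule_eq_zero_of_dvd hM (dvd_tupleProd_cons_of_eq_zero z y t hk) x

/-- A tuple avoiding the index of `z` factors through `Fin.succ`. [folklore] -/
theorem exists_eq_succ_comp {n : ℕ} (t : Fin n → Fin (s + 1)) (h : ∀ k, t k ≠ 0) :
    ∃ t' : Fin n → Fin s, t = Fin.succ ∘ t' :=
  ⟨fun k => (t k).pred (h k), funext fun k => (Fin.succ_pred (t k) (h k)).symm⟩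

/-! ## The canonical identifications `M_{y_t} ≅ M_{(z,y)_{succ ∘ t}}` -/

/-- `M → M_{(z,y)_{succ ∘ t}}` is a localisation at the powers of `y_t`. [folklore] -/
instance isLocalizedModule_cons_succ {n : ℕ} (t : Fin n → Fin s) :
    IsLocalizedModule (Submonoid.powers (tupleProd y t))
      (LocalizedModule.mkLinearMap
        (Submonoid.powers (tupleProd (Fin.cons z y : Fin (s + 1) → R) (Fin.succ ∘ t))) M) := by
  rw [← tupleProd_cons_succ z y t]
  infer_instance

/-- **The identification `M_{y_t} ≅ M_{(z,y)_{succ ∘ t}}`.** [folklore] -/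
def consIso {n : ℕ} (t : Fin n → Fin s) :
    CechLoc y M t ≃ₗ[R] CechLoc (Fin.cons z y : Fin (s + 1) → R) M (Fin.succ ∘ t) :=
  IsLocalizedModule.iso (Submonoid.powers (tupleProd y t))
    (LocalizedModule.mkLinearMap
      (Submonoid.powers (tupleProd (Fin.cons z y : Fin (s + 1) → R) (Fin.succ ∘ t))) M)

/-- `consIso (m/1) = m/1`. [folklore] -/
@[simp]
theorem consIso_mk_one {n : ℕ} (t : Fin n → Fin s) (m : M) :
    consIso z y M t (LocalizedModule.mk m 1) = LocalizedModule.mk m 1 :=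
  IsLocalizedModule.iso_mk_one _ _ m

/-- `consIso⁻¹ (m/1) = m/1`. [folklore] -/
@[simp]
theorem consIso_symm_mk_one {n : ℕ} (t : Fin n → Fin s) (m : M) :
    (consIso z y M t).symm (LocalizedModule.mk m 1) = LocalizedModule.mk m 1 :=
  IsLocalizedModule.iso_symm_apply _ _ m

/-- **`consIso` commutes with the restriction maps.** [folklore] -/
theorem res_consIso {n n' : ℕ} (t : Fin n → Fin s) (θ : Fin n' → Fin n) (x : CechLoc y M (t ∘ θ)) :
    res (Fin.cons z y : Fin (s + 1) → R) M (Fin.succ ∘ t) θ (consIso z y M (t ∘ θ) x) =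
      consIso z y M t (res y M t θ x) := by
  have key : res (Fin.cons z y : Fin (s + 1) → R) M (Fin.succ ∘ t) θ ∘ₗ
        (consIso z y M (t ∘ θ)).toLinearMap =
      (consIso z y M t).toLinearMap ∘ₗ res y M t θ := by
    have hunits : ∀ x : Submonoid.powers (tupleProd y (t ∘ θ)),
        IsUnit (algebraMap R (Module.End R
          (CechLoc (Fin.cons z y : Fin (s + 1) → R) M (Fin.succ ∘ t))) x) := by
      intro x
      have h : ∀ x' : Submonoid.powers
          (tupleProd (Fin.cons z y : Fin (s + 1) → R) (Fin.succ ∘ t ∘ θ)),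
          IsUnit (algebraMap R (Module.End R
            (CechLoc (Fin.cons z y : Fin (s + 1) → R) M (Fin.succ ∘ t))) x') := fun x' =>
        isUnit_algebraMap_end_cechLoc_of_dvd
          (dvd_comp (Fin.cons z y : Fin (s + 1) → R) (Fin.succ ∘ t) θ) x'
      have hx : (x : R) ∈ Submonoid.powers
          (tupleProd (Fin.cons z y : Fin (s + 1) → R) (Fin.succ ∘ t ∘ θ)) := by
        rw [show Fin.succ ∘ t ∘ θ = Fin.succ ∘ (t ∘ θ) from rfl, tupleProd_cons_succ]
        exact x.2
      exact h ⟨x, hx⟩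
    apply IsLocalizedModule.ext (Submonoid.powers (tupleProd y (t ∘ θ)))
      (LocalizedModule.mkLinearMap (Submonoid.powers (tupleProd y (t ∘ θ))) M) hunits
    apply LinearMap.ext
    intro m
    change res (Fin.cons z y : Fin (s + 1) → R) M (Fin.succ ∘ t) θ
        (consIso z y M (t ∘ θ) (LocalizedModule.mk m 1)) =
      consIso z y M t (res y M t θ (LocalizedModule.mk m 1))
    rw [consIso_mk_one, res_mk_one, consIso_mk_one]
    exact res_mk_one (Fin.cons z y : Fin (s + 1) → R) M (Fin.succ ∘ t) θ m
  exact LinearMap.congr_fun key x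

/-! ## The restriction chain map -/

/-- **Restriction of cochains to the tuples avoiding `z`**:
`(c ↦ (t ↦ c(succ ∘ t)))`, read through `consIso`. [folklore] -/
def dropZero (n : ℕ) : CechObj (Fin.cons z y : Fin (s + 1) → R) M n →ₗ[R] CechObj y M n :=
  LinearMap.pi fun t => (consIso z y M t).symm.toLinearMap ∘ₗ LinearMap.proj (Fin.succ ∘ t)

/-- Components of `dropZero`. [folklore] -/
@[simp]
theorem dropZero_apply (n : ℕ) (c : CechObj (Fin.cons z y : Fin (s + 1) → R) M n)
    (t : Fin (n + 1) → Fin s) : dropZero z y M n c t = (consIso z y M t).symm (c (Fin.succ ∘ t)) := rfl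

/-- **`dropZero` commutes with the augmentations.** [folklore] -/
theorem dropZero_cechAug (m : M) :
    dropZero z y M 0 (cechAug (Fin.cons z y : Fin (s + 1) → R) M m) = cechAug y M m := by
  funext t
  rw [dropZero_apply, cechAug_apply, cechAug_apply, consIso_symm_mk_one]

/-- **`dropZero` commutes with the Čech differentials.** [folklore] -/
theorem dC_dropZero (n : ℕ) (c : CechObj (Fin.cons z y : Fin (s + 1) → R) M n) :
    dC n (dropZero z y M n c) = dropZero z y M (n + 1) (dC n c) := by
  funext t
  rw [dC_apply, dropZero_apply, dC_apply, map_sum]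
  refine Finset.sum_congr rfl fun i _ => ?_
  rw [map_zsmul, dropZero_apply]
  congr 1
  rw [LinearEquiv.eq_symm_apply, ← res_consIso, LinearEquiv.apply_symm_apply]
  rfl

variable {z y M}

/-- Cochains for `(z, y)` vanish on the tuples meeting the index of `z` when `M` is `z`-power
torsion. [cite: StacksProject, Tag 0A6R] -/
theorem apply_eq_zero_of_eq_zero (hM : ∀ m : M, ∃ N : ℕ, z ^ N • m = 0) {n : ℕ}
    (c : CechObj (Fin.cons z y : Fin (s + 1) → R) M n) (t : Fin (n + 1) → Fin (s + 1)) {k : Fin (n + 1)}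
    (hk : t k = 0) : c t = 0 :=
  cechLoc_cons_eq_zero hM t hk (c t)

/-- **`dropZero` is injective** for `z`-power-torsion `M`. [cite: StacksProject, Tag 0A6R] -/
theorem dropZero_injective (hM : ∀ m : M, ∃ N : ℕ, z ^ N • m = 0) (n : ℕ) :
    Function.Injective (dropZero z y M n) := by
  rw [← LinearMap.ker_eq_bot, eq_bot_iff]
  intro c hc
  rw [LinearMap.mem_ker] at hc
  rw [Submodule.mem_bot]
  have key : ∀ t' : Fin (n + 1) → Fin s, c (Fin.succ ∘ t') = 0 := by
    intro t'
    have := congrFun hc t'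
    rw [dropZero_apply, Pi.zero_apply, LinearEquiv.map_eq_zero_iff] at this
    exact this
  have key' : ∀ (t' : Fin (n + 1) → Fin s) (t : Fin (n + 1) → Fin (s + 1)),
      t = Fin.succ ∘ t' → c t = 0 := by
    rintro t' t rfl
    exact key t'
  funext t
  rw [Pi.zero_apply]
  by_cases h : ∃ k, t k = 0
  · obtain ⟨k, hk⟩ := h
    exact apply_eq_zero_of_eq_zero hM c t hk
  · push Not at h
    obtain ⟨t', ht'⟩ := exists_eq_succ_comp t h
    exact key' t' t ht'

/-- **`dropZero` is surjective** (for any `M`). [folklore] -/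
theorem dropZero_surjective (n : ℕ) : Function.Surjective (dropZero z y M n) := by
  classical
  rw [← LinearMap.range_eq_top, eq_top_iff]
  intro c _
  rw [← Finset.univ_sum_single c]
  refine Submodule.sum_mem _ fun t _ => ?_
  refine ⟨Pi.single (Fin.succ ∘ t) (consIso z y M t (c t)), funext fun t' => ?_⟩
  rw [dropZero_apply]
  by_cases h : t' = t
  · subst h
    rw [Pi.single_eq_same, Pi.single_eq_same, LinearEquiv.symm_apply_apply]
  · have h' : (Fin.succ ∘ t' : Fin (n + 1) → Fin (s + 1)) ≠ Fin.succ ∘ t := fun e =>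
      h (funext fun k => Fin.succ_injective _ (congrFun e k))
    rw [Pi.single_eq_of_ne h', Pi.single_eq_of_ne h, map_zero]

/-- **Dropping a nilpotent generator does not change local cohomology**: if every element of `M`
is killed by a power of `z`, then `Hⁱ_{(z, y_1, …, y_s)}(M) = 0` for `i < n` iff
`Hⁱ_{(y_1, …, y_s)}(M) = 0` for `i < n`. [cite: StacksProject, Tag 0A6R]
[cite: Cesnavicius2021, proof of Thm. 3.13] -/
theorem cechVanishBelow_cons_iff_of_torsion (hM : ∀ m : M, ∃ N : ℕ, z ^ N • m = 0) {n : ℕ} :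
    CechVanishBelow (Fin.cons z y : Fin (s + 1) → R) M n ↔ CechVanishBelow y M n :=
  cechVanishBelow_iff_of_bijective (fun n => dropZero z y M n)
    (fun n => ⟨dropZero_injective hM n, dropZero_surjective n⟩)
    (fun n c => dC_dropZero z y M n c) (fun m => dropZero_cechAug z y M m)

/-- **Dropping a generator that kills the module**: if `zM = 0` then
`Hⁱ_{(z, y)}(M) = 0` below `n` iff `Hⁱ_{(y)}(M) = 0` below `n`. [cite: StacksProject, Tag 0A6R] -/
theorem cechVanishBelow_cons_iff_of_smul_eq_zero (hM : ∀ m : M, z • m = 0) {n : ℕ} :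
    CechVanishBelow (Fin.cons z y : Fin (s + 1) → R) M n ↔ CechVanishBelow y M n :=
  cechVanishBelow_cons_iff_of_torsion (fun m => ⟨1, by rw [pow_one, hM m]⟩)

end Literature.RingTheory.LocalCohomology

end
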